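import Mathlib
import Summits.Ventures.HodgeRepro.Tier4.Common.RowWeights
import Summits.Ventures.HodgeRepro.Tier4.Common.LocalTorusCompact
import Summits.Ventures.HodgeRepro.Tier4.Common.RowTorus
import Summits.Ventures.HodgeRepro.Tier4.Common.CompactHaarProbability
import Summits.Ventures.HodgeRepro.Tier4.Common.MixedPlaneKType
import Summits.Ventures.HodgeRepro.Tier4.Line4.KTypeOfPeriodClosed
import Summits.Ventures.HodgeRepro.Tier4.Line4.KTypeOfPeriodRow

/-!
# Tier4/Line4/KTypeOfPeriodTransported — C-L4-WEIGHTS (seesaw transport): C-L4-KTYPE on a row plane WITH A TRANSPORTED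
SECOND TORUS — the shape of the wall's `seesawPlane`

Blind re-derivation cell `pub-hodge-repro`, Tier 4 «prove the step» (README §9–§10), seat t4-L4-p1 (prover, LINE L4,
gen 4; plan-4 g3's «next small cut» S14688: the seesaw transport of `hasKTypeAt_of_period_ne_zero_row`).  Tree path
`lean/Summits/Ventures/HodgeRepro/Tier4/Line4/KTypeOfPeriodTransported.lean`.  Mathlib-level; no literature.

WHAT IS PROVED.  The wall's plane is `seesawPlane q a g g' … = (PlaneData.mixedRow q (a 0) (a 2)).withTransportedTorus g g' …`
(L4 v0.30 L506), i.e. the row plane `PlaneData.ofLinesRow q (a 0) (a 2) (-1)` with its second torus transported by `g`: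
`withTransportedTorus` keeps `B`, `Ω`, `P` and changes only `Q` (typer-2's MixedPlaneKType (γ)).  Everything the
`T`-side `K`-type theorem of KTypeOfPeriodRow uses — `GA`, `torusT`, `localTorusAt`, `weightAt`, `HasKTypeAt`, `periodLin`
over `torusT`, `ChiMatchesAt` — depends on the plane through `B`, `Ω`, `P` only, so the row-plane facts
(`compactSpace_localTorusAt_ofLinesRow`, `isMulRightInvariant_torusT_ofLinesRow`, `weightChar_localTorusAt_mul`,
`norm_weightChar_localTorusAt_eq_one`, `continuous_weightChar_localTorusAt`) hold on the transported plane BY DEFINITIONAL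
UNFOLDING (each `exact` below is such a transport, kernel-checked), and `hasKTypeAt_of_period_ne_zero_span`
(KTypeOfPeriodClosed, any plane) assembles them exactly as on the row plane.  What differs between the two planes is the
PRIMED data of `R : RTFData _` (`torusT'`, `μT'`, `DT'`, `chi'`) — which the `T`-side theorem never touches.  Hence:
* `hasKTypeAt_of_period_ne_zero_transported` — the row theorem on `(ofLinesRow q a b ε).withTransportedTorus g g' hgg' hg'g hgΩ`
  with `R : RTFData` OF THAT PLANE (no `R.toRow` construction, no hypothesis on the primed data beyond the Setting's own
  `[R.μT'.IsHaarMeasure]`, `compT'`);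
* `hasKTypeAt_of_period_ne_zero_mixedRow_transported` — the instance `ε = -1` in the `mixedRow` spelling, which is the
  wall's `seesawPlane q a g g' hgg' hg'g hgΩ` at `a := a 0`, `b := a 2` after unfolding `seesawPlane` (v0.30 L506–L510).

Nothing here says anything about the status of the Hodge conjecture for CM abelian varieties, which is NOT proved
(HC_CM is NOT proved by anyone in this repository).
-/

set_option autoImplicit false

noncomputable section

namespace Summit.Ventures.HodgeRepro.Tier4.Line4

open Summit.Ventures.HodgeRepro.Tier4.Common Summit.Ventures.HodgeRepro.Tier4.Line1 MeasureTheory NumberField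
open scoped ComplexConjugate

section Transported

variable {k : Type} [Field k] [NumberField k] (q : QuadData k) (a b ε : k)
  (g g' : Matrix (Fin 4) (Fin 4) k) (hgg' : g * g' = 1) (hg'g : g' * g = 1)
  (hgΩ : g * (PlaneData.ofLinesRow q a b ε).Ω = (PlaneData.ofLinesRow q a b ε).Ω * g)

/-- **The local torus of the transported row plane is compact** (transport of `compactSpace_localTorusAt_ofLinesRow`:
`localTorusAt` depends on `B`, `Ω`, `P` only). -/
theorem compactSpace_localTorusAt_withTransportedTorus (ha : a ≠ 0) (hb : b ≠ 0) (hε : ε ≠ 0)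
    {w : InfinitePlace k} (hw : w.IsReal) (hcm : IsCMAt q w) :
    CompactSpace (localTorusAt ((PlaneData.ofLinesRow q a b ε).withTransportedTorus g g' hgg' hg'g hgΩ) w) :=
  compactSpace_localTorusAt_ofLinesRow q a b ε ha hb hε hw hcm

/-- **A left-invariant measure on the torus `T` of the transported row plane is right-invariant** (the torus is
commutative: transport of `isMulRightInvariant_torusT_ofLinesRow`). -/
theorem isMulRightInvariant_torusT_withTransportedTorus (ha : a ≠ 0) (hb : b ≠ 0) (hε : ε ≠ 0)
    [MeasurableSpace (torusT ((PlaneData.ofLinesRow q a b ε).withTransportedTorus g g' hgg' hg'g hgΩ))]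
    (μT : Measure (torusT ((PlaneData.ofLinesRow q a b ε).withTransportedTorus g g' hgg' hg'g hgΩ)))
    [μT.IsMulLeftInvariant] : μT.IsMulRightInvariant :=
  isMulRightInvariant_of_forall_comm μT fun s t =>
    Subtype.ext (torusT_ofLinesRow_comm q a b ε ha hb hε s.1 t.1 s.2 t.2)

/-- **The weight character of the transported row plane is multiplicative on the local torus** (transport of
`weightChar_localTorusAt_mul`). -/
theorem weightChar_localTorusAt_mul_withTransportedTorus (ha : a ≠ 0) (hb : b ≠ 0) (hε : ε ≠ 0) {w : InfinitePlace k}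
    (hw : w.IsReal) (hcm : IsCMAt q w) (ePlus eMinus : ℤ) :
    ∀ κ ∈ localTorusAt ((PlaneData.ofLinesRow q a b ε).withTransportedTorus g g' hgg' hg'g hgΩ) w,
      ∀ κ' ∈ localTorusAt ((PlaneData.ofLinesRow q a b ε).withTransportedTorus g g' hgg' hg'g hgΩ) w,
      weightAt ((PlaneData.ofLinesRow q a b ε).withTransportedTorus g g' hgg' hg'g hgΩ) q w 0 (κ * κ') ^ ePlus *
          weightAt ((PlaneData.ofLinesRow q a b ε).withTransportedTorus g g' hgg' hg'g hgΩ) q w 1 (κ * κ') ^ eMinus =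
        (weightAt ((PlaneData.ofLinesRow q a b ε).withTransportedTorus g g' hgg' hg'g hgΩ) q w 0 κ ^ ePlus *
            weightAt ((PlaneData.ofLinesRow q a b ε).withTransportedTorus g g' hgg' hg'g hgΩ) q w 1 κ ^ eMinus) *
          (weightAt ((PlaneData.ofLinesRow q a b ε).withTransportedTorus g g' hgg' hg'g hgΩ) q w 0 κ' ^ ePlus *
            weightAt ((PlaneData.ofLinesRow q a b ε).withTransportedTorus g g' hgg' hg'g hgΩ) q w 1 κ' ^ eMinus) :=
  weightChar_localTorusAt_mul q a b ε w ha hb hε hw hcm ePlus eMinus w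

/-- **The weight character of the transported row plane has unit modulus on the local torus** (transport of
`norm_weightChar_localTorusAt_eq_one`). -/
theorem norm_weightChar_localTorusAt_eq_one_withTransportedTorus (ha : a ≠ 0) (hb : b ≠ 0) (hε : ε ≠ 0)
    {w : InfinitePlace k} (hw : w.IsReal) (hcm : IsCMAt q w) (ePlus eMinus : ℤ) :
    ∀ κ ∈ localTorusAt ((PlaneData.ofLinesRow q a b ε).withTransportedTorus g g' hgg' hg'g hgΩ) w,
      ‖weightAt ((PlaneData.ofLinesRow q a b ε).withTransportedTorus g g' hgg' hg'g hgΩ) q w 0 κ ^ ePlus *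
        weightAt ((PlaneData.ofLinesRow q a b ε).withTransportedTorus g g' hgg' hg'g hgΩ) q w 1 κ ^ eMinus‖ = 1 :=
  norm_weightChar_localTorusAt_eq_one q a b ε w ha hb hε hw hcm ePlus eMinus w

/-- **The weight character of the transported row plane is continuous on the local torus** (transport of
`continuous_weightChar_localTorusAt`). -/
theorem continuous_weightChar_localTorusAt_withTransportedTorus (ha : a ≠ 0) (hb : b ≠ 0) (hε : ε ≠ 0)
    {w : InfinitePlace k} (hw : w.IsReal) (hcm : IsCMAt q w) (ePlus eMinus : ℤ) :
    Continuous fun κ : localTorusAt ((PlaneData.ofLinesRow q a b ε).withTransportedTorus g g' hgg' hg'g hgΩ) w =>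
      weightAt ((PlaneData.ofLinesRow q a b ε).withTransportedTorus g g' hgg' hg'g hgΩ) q w 0 κ ^ ePlus *
        weightAt ((PlaneData.ofLinesRow q a b ε).withTransportedTorus g g' hgg' hg'g hgΩ) q w 1 κ ^ eMinus :=
  continuous_weightChar_localTorusAt q a b ε ha hb hε hw hcm ePlus eMinus

section Setting

variable [MeasurableSpace (GA ((PlaneData.ofLinesRow q a b ε).withTransportedTorus g g' hgg' hg'g hgΩ))]
  [BorelSpace (GA ((PlaneData.ofLinesRow q a b ε).withTransportedTorus g g' hgg' hg'g hgΩ))]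
  (R : RTFData ((PlaneData.ofLinesRow q a b ε).withTransportedTorus g g' hgg' hg'g hgΩ))
  (μ : Measure (GA ((PlaneData.ofLinesRow q a b ε).withTransportedTorus g g' hgg' hg'g hgΩ)))
  [μ.IsHaarMeasure] [R.μT.IsHaarMeasure] [R.μT'.IsHaarMeasure]
  (DG : Set (GA ((PlaneData.ofLinesRow q a b ε).withTransportedTorus g g' hgg' hg'g hgΩ)))
  (fdG : IsFundamentalDomain (rationalPoints ((PlaneData.ofLinesRow q a b ε).withTransportedTorus g g' hgg' hg'g hgΩ)) DG μ)
  (compG : IsCompact (closure DG)) (compT : IsCompact (closure R.DT)) (compT' : IsCompact (closure R.DT'))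

/-- **C-L4-KTYPE on the transported row plane, every display bound by name** — the `T`-side `K`-type of a closed invariant
subspace from a non-vanishing `T`-period, for `R : RTFData` of the TRANSPORTED plane (the wall's `seesawPlane` shape). -/
theorem hasKTypeAt_of_period_ne_zero_transported (ha : a ≠ 0) (hb : b ≠ 0) (hε : ε ≠ 0) {w : InfinitePlace k}
    (hw : w.IsReal) (hcm : IsCMAt q w) (eP eM : InfinitePlace k → ℤ)
    (hu : ∀ t, ‖R.chi t‖ = 1) (hc : Continuous R.chi)
    (hmatch : ChiMatchesAt ((PlaneData.ofLinesRow q a b ε).withTransportedTorus g g' hgg' hg'g hgΩ) q w (eP w) (eM w) R.chi)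
    {U : Set (GA ((PlaneData.ofLinesRow q a b ε).withTransportedTorus g g' hgg' hg'g hgΩ) → ℂ)}
    (hU : (Setting.ofAdelicData ((PlaneData.ofLinesRow q a b ε).withTransportedTorus g g' hgg' hg'g hgΩ) R μ DG fdG
      compG compT compT').IsInvariantSubspace U)
    (hcl : IsClosedSub (Setting.ofAdelicData ((PlaneData.ofLinesRow q a b ε).withTransportedTorus g g' hgg' hg'g hgΩ) R μ
      DG fdG compG compT compT') U)
    {f : GA ((PlaneData.ofLinesRow q a b ε).withTransportedTorus g g' hgg' hg'g hgΩ) → ℂ} (hf : f ∈ Submodule.span ℂ U)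
    (hP : periodLin ((PlaneData.ofLinesRow q a b ε).withTransportedTorus g g' hgg' hg'g hgΩ) R.μT R.DT R.chi
      (restrictTo ((PlaneData.ofLinesRow q a b ε).withTransportedTorus g g' hgg' hg'g hgΩ)
        (torusT ((PlaneData.ofLinesRow q a b ε).withTransportedTorus g g' hgg' hg'g hgΩ)) f) ≠ 0) :
    HasKTypeAt ((PlaneData.ofLinesRow q a b ε).withTransportedTorus g g' hgg' hg'g hgΩ) q w (eP w) (eM w)
      (Submodule.span ℂ U) := by
  haveI : R.μT.IsMulRightInvariant :=
    isMulRightInvariant_torusT_withTransportedTorus q a b ε g g' hgg' hg'g hgΩ ha hb hε R.μT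
  haveI : CompactSpace (localTorusAt ((PlaneData.ofLinesRow q a b ε).withTransportedTorus g g' hgg' hg'g hgΩ) w) :=
    compactSpace_localTorusAt_withTransportedTorus q a b ε g g' hgg' hg'g hgΩ ha hb hε hw hcm
  haveI := isHaarMeasure_haarProb (localTorusAt ((PlaneData.ofLinesRow q a b ε).withTransportedTorus g g' hgg' hg'g hgΩ) w)
  haveI := isProbabilityMeasure_haarProb
    (localTorusAt ((PlaneData.ofLinesRow q a b ε).withTransportedTorus g g' hgg' hg'g hgΩ) w)
  exact hasKTypeAt_of_period_ne_zero_span ((PlaneData.ofLinesRow q a b ε).withTransportedTorus g g' hgg' hg'g hgΩ) R μ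
    DG fdG compG compT compT' w q eP eM
    (haarProb (localTorusAt ((PlaneData.ofLinesRow q a b ε).withTransportedTorus g g' hgg' hg'g hgΩ) w)) hu hc
    (weightChar_localTorusAt_mul_withTransportedTorus q a b ε g g' hgg' hg'g hgΩ ha hb hε hw hcm (eP w) (eM w))
    (continuous_weightChar_localTorusAt_withTransportedTorus q a b ε g g' hgg' hg'g hgΩ ha hb hε hw hcm (eP w) (eM w))
    (fun κ => norm_weightChar_localTorusAt_eq_one_withTransportedTorus q a b ε g g' hgg' hg'g hgΩ ha hb hε hw hcm
      (eP w) (eM w) κ κ.2)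
    hmatch hU hcl hf hP

end Setting

end Transported

section OfEq

variable {k : Type} [Field k] [NumberField k] (q : QuadData k) (a b ε : k)
  (g g' : Matrix (Fin 4) (Fin 4) k) (hgg' : g * g' = 1) (hg'g : g' * g = 1)
  (hgΩ : g * (PlaneData.ofLinesRow q a b ε).Ω = (PlaneData.ofLinesRow q a b ε).Ω * g)
  (W : PlaneData k) [MeasurableSpace (GA W)] [BorelSpace (GA W)] (R : RTFData W) (μ : Measure (GA W))
  [μ.IsHaarMeasure] [R.μT.IsHaarMeasure] [R.μT'.IsHaarMeasure] (DG : Set (GA W))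
  (fdG : IsFundamentalDomain (rationalPoints W) DG μ) (compG : IsCompact (closure DG))
  (compT : IsCompact (closure R.DT)) (compT' : IsCompact (closure R.DT'))

/-- **The consumer's form**: the same statement for ANY plane `W` given by an equation
`hW : W = (PlaneData.ofLinesRow q a b ε).withTransportedTorus g g' hgg' hg'g hgΩ` — for the wall's `seesawPlane`
the equation is `rfl` (unfold `seesawPlane`, `PlaneData.mixedRow`), and every instance / datum stays on `W` itself
(no definitional transport at the call site). -/
theorem hasKTypeAt_of_period_ne_zero_of_eq_transported
    (hW : W = (PlaneData.ofLinesRow q a b ε).withTransportedTorus g g' hgg' hg'g hgΩ)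
    (ha : a ≠ 0) (hb : b ≠ 0) (hε : ε ≠ 0) {w : InfinitePlace k} (hw : w.IsReal) (hcm : IsCMAt q w)
    (eP eM : InfinitePlace k → ℤ) (hu : ∀ t, ‖R.chi t‖ = 1) (hc : Continuous R.chi)
    (hmatch : ChiMatchesAt W q w (eP w) (eM w) R.chi)
    {U : Set (GA W → ℂ)} (hU : (Setting.ofAdelicData W R μ DG fdG compG compT compT').IsInvariantSubspace U)
    (hcl : IsClosedSub (Setting.ofAdelicData W R μ DG fdG compG compT compT') U)
    {f : GA W → ℂ} (hf : f ∈ Submodule.span ℂ U)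
    (hP : periodLin W R.μT R.DT R.chi (restrictTo W (torusT W) f) ≠ 0) :
    HasKTypeAt W q w (eP w) (eM w) (Submodule.span ℂ U) := by
  subst hW
  exact hasKTypeAt_of_period_ne_zero_transported q a b ε g g' hgg' hg'g hgΩ R μ DG fdG compG compT compT' ha hb hε
    hw hcm eP eM hu hc hmatch hU hcl hf hP

end OfEq

section MixedRow

variable {k : Type} [Field k] [NumberField k] (q : QuadData k) (a b : k)
  (g g' : Matrix (Fin 4) (Fin 4) k) (hgg' : g * g' = 1) (hg'g : g' * g = 1)
  (hgΩ : g * (PlaneData.mixedRow q a b).Ω = (PlaneData.mixedRow q a b).Ω * g)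
  (W : PlaneData k) [MeasurableSpace (GA W)] [BorelSpace (GA W)] (R : RTFData W) (μ : Measure (GA W))
  [μ.IsHaarMeasure] [R.μT.IsHaarMeasure] [R.μT'.IsHaarMeasure] (DG : Set (GA W))
  (fdG : IsFundamentalDomain (rationalPoints W) DG μ) (compG : IsCompact (closure DG))
  (compT : IsCompact (closure R.DT)) (compT' : IsCompact (closure R.DT'))

/-- **C-L4-KTYPE on the wall's plane**: `W = (PlaneData.mixedRow q a b).withTransportedTorus g g' hgg' hg'g hgΩ` is
`seesawPlane q a⃗ g g' hgg' hg'g hgΩ` at `a := a⃗ 0`, `b := a⃗ 2` (L4 v0.30 L506–L510, the equation is `rfl` there;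
`mixedRow q a b = ofLinesRow q a b (-1)`). -/
theorem hasKTypeAt_of_period_ne_zero_mixedRow_transported
    (hW : W = (PlaneData.mixedRow q a b).withTransportedTorus g g' hgg' hg'g hgΩ)
    (ha : a ≠ 0) (hb : b ≠ 0) {w : InfinitePlace k} (hw : w.IsReal) (hcm : IsCMAt q w)
    (eP eM : InfinitePlace k → ℤ) (hu : ∀ t, ‖R.chi t‖ = 1) (hc : Continuous R.chi)
    (hmatch : ChiMatchesAt W q w (eP w) (eM w) R.chi)
    {U : Set (GA W → ℂ)} (hU : (Setting.ofAdelicData W R μ DG fdG compG compT compT').IsInvariantSubspace U)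
    (hcl : IsClosedSub (Setting.ofAdelicData W R μ DG fdG compG compT compT') U)
    {f : GA W → ℂ} (hf : f ∈ Submodule.span ℂ U)
    (hP : periodLin W R.μT R.DT R.chi (restrictTo W (torusT W) f) ≠ 0) :
    HasKTypeAt W q w (eP w) (eM w) (Submodule.span ℂ U) :=
  hasKTypeAt_of_period_ne_zero_of_eq_transported q a b (-1) g g' hgg' hg'g hgΩ W R μ DG fdG compG compT compT' hW ha hb
    (neg_ne_zero.2 one_ne_zero) hw hcm eP eM hu hc hmatch hU hcl hf hP

end MixedRow

end Summit.Ventures.HodgeRepro.Tier4.Line4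

end
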